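import Literature.AlgebraicGeometry.Modules.SerreTwistModCharts
import Literature.AlgebraicGeometry.Modules.SheafHom
import HarnessLib

/-!
# `𝓗om(𝒪_Z(-m), G) ≅ G(m)`: morphisms out of Serre's twisting sheaf are twisted sections

For `ι : Z ⟶ 𝐏ʳ_A`, an `𝒪_Z`-module `G` and `m ∈ ℕ`, this file compares the tree's internal Hom
`sheafHom (serreTwist ι m) G` (`Modules/SheafHom`: sections over `U` are the morphisms
`𝒪_Z(-m)|_U ⟶ G|_U`) with the Čech-gluing model `twistMod ι G m = G(m)` of `Modules/SerreTwistMod`: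

* `SerreTwist.homToTwist ι G m : sheafHom (serreTwist ι m) G ⟶ twistMod ι G m` — a morphism
  `φ : 𝒪_Z(-m)|_U → G|_U` goes to the family of its values `φ(v_j|_{U ∩ Z_j}) ∈ Γ(G, U ∩ Z_j)` on the local
  generators `v_j` (`Modules/SerreTwistCharts`), a twist family of degree `m` because
  `v_j = (x_{j'}/x_j)^m v_{j'}` (`gen_restrict_eq_smul_gen`);
* `SerreTwist.isIso_homToTwist` — **it is an isomorphism** (`𝓗om(𝒪(-m), G) ≅ G ⊗ 𝒪(m) = G(m)`,
  Hartshorne II Prop. 5.12 (c), Ex. 5.1 (b)): injective since a morphism out of `𝒪(-m)|_U` is determined by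
  its values on the `v_j` (every section over `W ⊆ Z_j` is `f_{j⋯j} · v_j`, `eq_smul_gen`), surjective by
  gluing (`Modules/SheafHom.glueHom`) the morphisms `pieceHom` (`f ↦ f_{j⋯j} · n_j` on `U ∩ Z_j`);
* `SerreTwist.homOfTwistSection` — the morphism `𝒪_Z(-m) ⟶ G` attached to a GLOBAL section of `G(m)`
  (the sections `g_j` of Serre's theorem A become a morphism `⊕ 𝒪_Z(-m) → G`), with its values
  `homOfTwistSection_app_smul_gen`.

Everything is proved; no named facts.

References: Hartshorne II Prop. 5.12, Ex. 5.1; EGA 0_I 5.4. [Hartshorne1977]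
-/

noncomputable section

universe u

open CategoryTheory AlgebraicGeometry TopologicalSpace Opposite
open Literature.Algebra.Homology Literature.Algebra.Homology.LaurentCech
open Literature.AlgebraicGeometry.Morphisms Literature.AlgebraicGeometry.Morphisms.ProjCech

attribute [local instance] MvPolynomial.gradedAlgebra
  Literature.AlgebraicGeometry.Motives.ProjBaseChange.algebraBase

namespace Literature.AlgebraicGeometry.Modules

namespace SerreTwist

variable {A : Type u} [CommRing A] {r : ℕ} {Z : Scheme.{u}} (ι : Z ⟶ PP A r) (G : Z.Modules) (m : ℕ)

/-! ## The values of a morphism `𝒪_Z(-m)|_U → G|_U` on the local generators -/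

omit G in
/-- The chart function of a constant word: `μ_{i⋯i}/x_j^m = (x_i/x_j)^m`. [folklore] -/
theorem wordFun_const' (i j : Fin (r + 1)) : wordFun ι j (fun _ : Fin m => i) = chartFun ι i j ^ m := by
  rw [wordFun, Finset.prod_const, Finset.card_univ, Fintype.card_fin]

/-- The local generator `v_j` restricted to `U ∩ Z_j`. [folklore] -/
def genAt (U : Z.Opens) (j : Fin (r + 1)) : Γ(serreTwist ι m, U ⊓ Zop ι {j}) :=
  (serreTwist ι m).presheaf.map (homOfLE (inf_le_right : U ⊓ Zop ι {j} ≤ Zop ι {j})).op (gen ι m j)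

/-- Restricting `genAt` into an open `V ⊆ Z_j`. [folklore] -/
theorem map_genAt (U : Z.Opens) (j : Fin (r + 1)) {V : Z.Opens} (h : V ≤ U ⊓ Zop ι {j}) :
    (serreTwist ι m).presheaf.map (homOfLE h).op (genAt ι m U j) =
      (serreTwist ι m).presheaf.map (homOfLE (h.trans inf_le_right)).op (gen ι m j) := by
  rw [genAt, moduleMap_map_apply]

/-- The `j⋯j`-coordinate of `genAt` is `1`. [folklore] -/
theorem coeff_genAt_const (U : Z.Opens) (j : Fin (r + 1)) : coeff ι (genAt ι m U j) (fun _ => j) = 1 := by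
  rw [genAt, coeff_map, coeff_gen_const, map_one]

/-- The family of values `φ(v_j|_{U ∩ Z_j})` of a morphism `φ : 𝒪_Z(-m)|_U → G|_U`. [folklore] -/
def homFamily {U : Z.Opens} (φ : (serreTwist ι m).over U ⟶ G.over U) : ChartFamily ι G U :=
  fun j => appLE φ (homOfLE (inf_le_left : U ⊓ Zop ι {j} ≤ U)) (genAt ι m U j)

/-- The values of `φ` on a section over `W ⊆ U ∩ Z_j` in terms of its value on `v_j`:
`φ(f) = f_{j⋯j} · φ(v_j)|_W`. [folklore] -/
theorem appLE_eq_coeff_smul {U W : Z.Opens} (φ : (serreTwist ι m).over U ⟶ G.over U) {j : Fin (r + 1)}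
    (hW : W ≤ U ⊓ Zop ι {j}) (k : W ⟶ U) (f : Γ(serreTwist ι m, W)) :
    appLE φ k f = coeff ι f (fun _ => j) • G.presheaf.map (homOfLE hW).op (homFamily ι G m φ j) := by
  have hf := eq_smul_gen ι (hW.trans inf_le_right) f
  rw [← map_genAt ι m U j hW] at hf
  conv_lhs => rw [hf]
  rw [appLE_smul_right, homFamily, ← appLE_map]
  exact congrArg _ (appLE_congr_hom _ _ _ _)

/-- **The values on the generators form a twist family of degree `m`** (`v_j = (x_{j'}/x_j)^m v_{j'}`).
[folklore] -/
theorem isTwistFamily_homFamily {U : Z.Opens} (φ : (serreTwist ι m).over U ⟶ G.over U) :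
    IsTwistFamily ι G m U (homFamily ι G m φ) := by
  intro j j' V hV hj hj'
  have hVj : V ≤ U ⊓ Zop ι {j} := le_inf hV hj
  have hVj' : V ≤ U ⊓ Zop ι {j'} := le_inf hV hj'
  -- the left-hand side is `φ(v_j|_V)`, computed in the chart `j'`
  have h1 : G.presheaf.map (homOfLE hVj).op (homFamily ι G m φ j) =
      appLE φ (homOfLE hV) ((serreTwist ι m).presheaf.map (homOfLE hVj).op (genAt ι m U j)) := by
    rw [homFamily, ← appLE_map]
    exact appLE_congr_hom _ _ _ _
  rw [moduleMap_congr G (le_inf hV hj) hVj, h1, appLE_eq_coeff_smul ι G m φ hVj' (homOfLE hV), map_genAt,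
    coeff_map, coeff_gen, wordFun_const', map_pow, moduleMap_congr G hVj' (le_inf hV hj')]

/-- `φ ↦ (φ(v_j))_j` as an additive map `Γ(U, 𝓗om(𝒪(-m), G)) → Γ(U, G(m))`. [folklore] -/
def homToTwistApp (U : Z.Opens) : ((serreTwist ι m).over U ⟶ G.over U) →+ Γ(twistMod ι G m, U) where
  toFun φ := mkFamily ι G (homFamily ι G m φ) (isTwistFamily_homFamily ι G m φ)
  map_zero' := twistMod_ext ι G fun _ => rfl
  map_add' _ _ := twistMod_ext ι G fun _ => rfl

/-- Components of `homToTwistApp`. [folklore] -/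
@[simp]
theorem comp_homToTwistApp (U : Z.Opens) (φ : (serreTwist ι m).over U ⟶ G.over U) (j : Fin (r + 1)) :
    comp ι G (homToTwistApp ι G m U φ) j = appLE φ (homOfLE (inf_le_left : U ⊓ Zop ι {j} ≤ U)) (genAt ι m U j) := rfl

/-- **`𝓗om(𝒪_Z(-m), G) ⟶ G(m)`**, `φ ↦ (φ(v_j|_{U ∩ Z_j}))_j`. [folklore] -/
def homToTwist : sheafHom (serreTwist ι m) G ⟶ twistMod ι G m :=
  homMkTwist ι G m (fun U => homToTwistApp ι G m U)
    (fun U V h φ j => by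
      have hg : genAt ι m V j =
          (serreTwist ι m).presheaf.map (homOfLE (inf_le_inf_right (Zop ι {j}) h)).op (genAt ι m U j) := by
        rw [map_genAt]; rfl
      change appLE (restrictHom (homOfLE h) φ) (homOfLE inf_le_left) (genAt ι m V j) =
        G.presheaf.map (homOfLE (inf_le_inf_right (Zop ι {j}) h)).op (appLE φ (homOfLE inf_le_left) (genAt ι m U j))
      rw [appLE_restrictHom, hg, ← appLE_map]
      exact appLE_congr_hom _ _ _ _)
    (fun U a φ j => rfl)

/-- Components of `homToTwist` on sections. [folklore] -/
theorem comp_homToTwist_app (U : Z.Opens) (φ : Γ(sheafHom (serreTwist ι m) G, U)) (j : Fin (r + 1)) :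
    comp ι G ((homToTwist ι G m).app U φ) j =
      appLE (show (serreTwist ι m).over U ⟶ G.over U from φ) (homOfLE (inf_le_left : U ⊓ Zop ι {j} ≤ U))
        (genAt ι m U j) := rfl

/-! ## Injectivity: a morphism out of `𝒪_Z(-m)|_U` is determined by its values on the `v_j` -/

/-- **Injectivity of `homToTwist` on sections.** [folklore] -/
theorem homToTwist_app_injective (U : Z.Opens) : Function.Injective ((homToTwist ι G m).app U) := by
  intro φ ψ h
  change ((serreTwist ι m).over U ⟶ G.over U) at φ
  change ((serreTwist ι m).over U ⟶ G.over U) at ψ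
  have hj : ∀ j, homFamily ι G m φ j = homFamily ι G m ψ j := fun j => congrArg (fun n => comp ι G n j) h
  refine hom_ext_of_appLE fun W k f => ?_
  apply TopCat.Sheaf.eq_of_locally_eq' ((SheafOfModules.toSheaf _).obj G) (fun j => W ⊓ Zop ι {j}) W
    (fun j => homOfLE inf_le_left) (le_iSup_inf_Zop ι W)
  intro j
  change G.presheaf.map (homOfLE inf_le_left).op (appLE φ k f) = G.presheaf.map (homOfLE inf_le_left).op (appLE ψ k f)
  have hWj : W ⊓ Zop ι {j} ≤ U ⊓ Zop ι {j} := inf_le_inf_right _ k.le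
  rw [← appLE_map, ← appLE_map, appLE_eq_coeff_smul ι G m φ hWj, appLE_eq_coeff_smul ι G m ψ hWj, hj j]

/-! ## Surjectivity: gluing the morphisms `f ↦ f_{j⋯j} · n_j` -/

/-- The value `f ↦ f_{j⋯j} · n|_W` of the piece morphism on a section over `W ⊆ V`. [folklore] -/
def pieceFun (j : Fin (r + 1)) {V W : Z.Opens} (n : Γ(G, V)) (hW : W ≤ V) (f : Γ(serreTwist ι m, W)) : Γ(G, W) :=
  coeff ι f (fun _ => j) • G.presheaf.map (homOfLE hW).op n

/-- `pieceFun` is additive. [folklore] -/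
theorem pieceFun_add (j : Fin (r + 1)) {V W : Z.Opens} (n : Γ(G, V)) (hW : W ≤ V) (f f' : Γ(serreTwist ι m, W)) :
    pieceFun ι G m j n hW (f + f') = pieceFun ι G m j n hW f + pieceFun ι G m j n hW f' := by
  rw [pieceFun, coeff_add, add_smul]; rfl

/-- `pieceFun` of zero. [folklore] -/
theorem pieceFun_zero (j : Fin (r + 1)) {V W : Z.Opens} (n : Γ(G, V)) (hW : W ≤ V) :
    pieceFun ι G m j n hW (0 : Γ(serreTwist ι m, W)) = 0 := by
  rw [pieceFun, coeff_zero, zero_smul]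

/-- `pieceFun` is `Γ(Z, W)`-linear. [folklore] -/
theorem pieceFun_smul (j : Fin (r + 1)) {V W : Z.Opens} (n : Γ(G, V)) (hW : W ≤ V) (a : Γ(Z, W))
    (f : Γ(serreTwist ι m, W)) : pieceFun ι G m j n hW (a • f) = a • pieceFun ι G m j n hW f := by
  rw [pieceFun, pieceFun, coeff_smul, mul_smul]

/-- `pieceFun` commutes with restriction. [folklore] -/
theorem pieceFun_map (j : Fin (r + 1)) {V W W' : Z.Opens} (n : Γ(G, V)) (hW : W ≤ V) (h : W' ≤ W)
    (f : Γ(serreTwist ι m, W)) :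
    pieceFun ι G m j n (h.trans hW) ((serreTwist ι m).presheaf.map (homOfLE h).op f) =
      G.presheaf.map (homOfLE h).op (pieceFun ι G m j n hW f) := by
  rw [pieceFun, pieceFun, coeff_map, Scheme.Modules.map_smul, moduleMap_map_apply]

/-- **The morphism `𝒪_Z(-m)|_V → G|_V` attached to a section `n ∈ Γ(G, V)`** (meant for `V ⊆ Z_j`): on
sections over `W ⊆ V`, `f ↦ f_{j⋯j} · n|_W`. [folklore] -/
def pieceHom (j : Fin (r + 1)) {V : Z.Opens} (n : Γ(G, V)) : (serreTwist ι m).over V ⟶ G.over V where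
  val := PresheafOfModules.homMk
    { app := fun W => AddCommGrpCat.ofHom
        { toFun := fun f => pieceFun ι G m j n W.unop.hom.le (@id Γ(serreTwist ι m, W.unop.left) f)
          map_zero' := pieceFun_zero ι G m j n W.unop.hom.le
          map_add' := fun f f' => pieceFun_add ι G m j n W.unop.hom.le f f' }
      naturality := fun {W W'} g => by
        ext f
        change pieceFun ι G m j n W'.unop.hom.le ((serreTwist ι m).presheaf.map g.unop.left.op f) =
          G.presheaf.map g.unop.left.op (pieceFun ι G m j n W.unop.hom.le f)
        have hg : g.unop.left = homOfLE g.unop.left.le := Subsingleton.elim _ _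
        rw [hg]
        exact pieceFun_map ι G m j n W.unop.hom.le g.unop.left.le f }
    (fun W a f => pieceFun_smul ι G m j n W.unop.hom.le a f)

/-- Values of `pieceHom`: `f ↦ f_{j⋯j} · n|_W`. [folklore] -/
theorem appLE_pieceHom (j : Fin (r + 1)) {V W : Z.Opens} (n : Γ(G, V)) (k : W ⟶ V) (f : Γ(serreTwist ι m, W)) :
    appLE (pieceHom ι G m j n) k f = coeff ι f (fun _ => j) • G.presheaf.map (homOfLE k.le).op n := rfl

/-- On `V ⊆ Z_j ∩ Z_{j'}`, the `j'⋯j'`-coordinate is the `j⋯j`-coordinate times `(x_{j'}/x_j)^m`. [folklore] -/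
theorem coeff_const_eq_mul {V : Z.Opens} {j : Fin (r + 1)} (hj : V ≤ Zop ι {j}) (j' : Fin (r + 1))
    (f : Γ(serreTwist ι m, V)) :
    coeff ι f (fun _ => j') = coeff ι f (fun _ => j) * Z.presheaf.map (homOfLE hj).op (chartFun ι j' j) ^ m := by
  rw [coeff_eq_coeff_const_mul ι hj f (fun _ => j'), wordFun_const', map_pow]

/-- **The pieces are compatible on overlaps** when `(n_j)_j` is a twist family of degree `m`. [folklore] -/
theorem restrictHom_pieceHom_eq {U : Z.Opens} (n : Γ(twistMod ι G m, U)) (j j' : Fin (r + 1)) :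
    restrictHom (Opens.infLELeft (U ⊓ Zop ι {j}) (U ⊓ Zop ι {j'})) (pieceHom ι G m j (comp ι G n j)) =
      restrictHom (Opens.infLERight (U ⊓ Zop ι {j}) (U ⊓ Zop ι {j'})) (pieceHom ι G m j' (comp ι G n j')) := by
  refine hom_ext_of_appLE fun W k f => ?_
  have hW : W ≤ U := k.le.trans (inf_le_left.trans inf_le_left)
  have hj : W ≤ Zop ι {j} := k.le.trans (inf_le_left.trans inf_le_right)
  have hj' : W ≤ Zop ι {j'} := k.le.trans (inf_le_right.trans inf_le_right)
  rw [appLE_restrictHom, appLE_restrictHom, appLE_pieceHom, appLE_pieceHom,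
    moduleMap_congr G _ (le_inf hW hj) (comp ι G n j), isTwistFamily_comp ι G n j j' hW hj hj', smul_smul,
    coeff_const_eq_mul ι m hj j' f, moduleMap_congr G _ (le_inf hW hj') (comp ι G n j')]

/-- The cover of `U` by the `U ∩ Z_j`, indexed in the universe of the scheme (for `glueHom`). [folklore] -/
def coverU (U : Z.Opens) : ULift.{u} (Fin (r + 1)) → Z.Opens := fun j => U ⊓ Zop ι {j.down}

/-- `U ⊆ ⨆_j (U ∩ Z_j)`. [folklore] -/
theorem le_iSup_coverU (U : Z.Opens) : U ≤ iSup (coverU ι U) := by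
  intro x hx
  have hx' : x ∈ (⊤ : Z.Opens) := trivial
  rw [← iSup_cover_eq_top ι] at hx'
  obtain ⟨j, hj⟩ := Opens.mem_iSup.mp hx'
  exact Opens.mem_iSup.mpr ⟨⟨j⟩, ⟨hx, hj⟩⟩

/-- **The morphism `𝒪_Z(-m)|_U → G|_U` with prescribed values `n_j` on the generators**, glued from the
pieces `pieceHom`. [folklore] -/
def homOfFamily {U : Z.Opens} (n : Γ(twistMod ι G m, U)) : (serreTwist ι m).over U ⟶ G.over U :=
  restrictHom (homOfLE (le_iSup_coverU ι U))
    (glueHom (coverU ι U) (fun j => pieceHom ι G m j.down (comp ι G n j.down))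
      fun j j' => restrictHom_pieceHom_eq ι G m n j.down j'.down)

/-- **`homToTwist (homOfFamily n) = n`**: the glued morphism has the prescribed values. [folklore] -/
theorem homToTwistApp_homOfFamily {U : Z.Opens} (n : Γ(twistMod ι G m, U)) :
    homToTwistApp ι G m U (homOfFamily ι G m n) = n := by
  refine twistMod_ext ι G fun j => ?_
  rw [comp_homToTwistApp, homOfFamily, appLE_restrictHom, appLE_glueHom]
  refine (glueValue_eq_appLE (coverU ι U) _ (fun j j' => restrictHom_pieceHom_eq ι G m n j.down j'.down) ⟨j⟩
    (𝟙 _) _ _).trans ?_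
  change appLE (pieceHom ι G m j (comp ι G n j)) (𝟙 (U ⊓ Zop ι {j})) (genAt ι m U j) = comp ι G n j
  rw [appLE_pieceHom, coeff_genAt_const, one_smul]
  exact map_id_apply G (comp ι G n j)

/-- **Surjectivity of `homToTwist` on sections.** [folklore] -/
theorem homToTwist_app_surjective (U : Z.Opens) : Function.Surjective ((homToTwist ι G m).app U) :=
  fun n => ⟨homOfFamily ι G m n, homToTwistApp_homOfFamily ι G m n⟩

/-- **`𝓗om(𝒪_Z(-m), G) ≅ G(m)`**: `homToTwist` is an isomorphism. [folklore] -/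
instance isIso_homToTwist : IsIso (homToTwist ι G m) :=
  Scheme.Modules.Hom.isIso_iff_isIso_app.mpr fun U =>
    (ConcreteCategory.isIso_iff_bijective _).mpr ⟨homToTwist_app_injective ι G m U, homToTwist_app_surjective ι G m U⟩

/-- The isomorphism `𝓗om(𝒪_Z(-m), G) ≅ G(m)`. [folklore] -/
def sheafHomTwistIso : sheafHom (serreTwist ι m) G ≅ twistMod ι G m := asIso (homToTwist ι G m)

/-! ## Morphisms `𝒪_Z(-m) ⟶ G` from global sections of `G(m)` -/

/-- The identification of `𝒪_Z`-modules with their restriction to the whole space: a morphism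
`E|_⊤ → M|_⊤` gives `E ⟶ M` (values through `appLE`). [folklore] -/
def homOfOverTop {E M : Z.Modules} (ψ : E.over ⊤ ⟶ M.over ⊤) : E ⟶ M where
  val := PresheafOfModules.homMk
    { app := fun U => AddCommGrpCat.ofHom
        { toFun := fun s => appLE ψ (homOfLE (le_top : U.unop ≤ ⊤)) s
          map_zero' := appLE_zero_right _ _
          map_add' := fun s s' => appLE_add_right _ _ s s' }
      naturality := fun {U V} g => by
        ext s
        change appLE ψ (homOfLE le_top) (E.presheaf.map g s) = M.presheaf.map g (appLE ψ (homOfLE le_top) s)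
        have hg : g = (homOfLE g.unop.le).op := Subsingleton.elim _ _
        rw [hg, ← appLE_map]
        exact appLE_congr_hom _ _ _ _ }
    (fun U a s => appLE_smul_right ψ (homOfLE le_top) a s)

/-- Values of `homOfOverTop`. [folklore] -/
@[simp]
theorem homOfOverTop_app {E M : Z.Modules} (ψ : E.over ⊤ ⟶ M.over ⊤) (U : Z.Opens) (s : Γ(E, U)) :
    (homOfOverTop ψ).app U s = appLE ψ (homOfLE (le_top : U ≤ ⊤)) s := rfl

/-- **The morphism `𝒪_Z(-m) ⟶ G` attached to a global section `n` of `G(m)`.** [folklore] -/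
def homOfTwistSection (n : Γ(twistMod ι G m, ⊤)) : serreTwist ι m ⟶ G := homOfOverTop (homOfFamily ι G m n)

/-- **Values of `homOfTwistSection n`**: on `V ⊆ Z_j`, `c · v_j|_V ↦ c · n_j|_V`, and in general
`f ↦ f_{j⋯j} · n_j|_V`. [folklore] -/
theorem homOfTwistSection_app {V : Z.Opens} (n : Γ(twistMod ι G m, ⊤)) {j : Fin (r + 1)} (hV : V ≤ Zop ι {j})
    (f : Γ(serreTwist ι m, V)) :
    (homOfTwistSection ι G m n).app V f =
      coeff ι f (fun _ => j) • G.presheaf.map (homOfLE (le_inf le_top hV : V ≤ ⊤ ⊓ Zop ι {j})).op (comp ι G n j) := by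
  rw [homOfTwistSection, homOfOverTop_app, appLE_eq_coeff_smul ι G m _ (le_inf le_top hV)]
  congr 2
  exact congrArg (fun x => comp ι G x j) (homToTwistApp_homOfFamily ι G m n)

end SerreTwist

end Literature.AlgebraicGeometry.Modules

end
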